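import Summits.HodgeConjecture.CorCM.HCCMCodimensionTwo
import HarnessLib

/-!
# `HC_CM` ⟺ the rational `(2,2)`-classes on ONE abelian variety per Galois CM field are algebraic

COR-CM (cell `pub-hodgecm2`), seat b24, count-neutral lane SLICE-EXHAUSTION, part 5 (theorems only, no definition, no named
fact).  Parts 1–4 gave `HC_CM ⟺` (slices at the Galois CM fields `F` of degree `≥ 6`) `⟺ W_RK4` (model) `⟺` (codimension-two HC
on the products `∏_{j<4} A_{(F,Θ_j)}` of four realisations).  Every such product is an isogeny factor of the fourth power
`P_F⁴` of the total product `P_F = ∏_{Θ ∈ CMType F} A_{(F,Θ)}` (part 1, `avDominatedBy_cmProdAV_powSucc_of_meets`), and rational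
`(p,p)`-classes descend along dominations degree by degree (`AndreSplit.mem_algebraicClasses_of_avDominatedBy`).  Hence ONE
abelian variety and ONE codimension per field:

* `codimTwo_powSucc_three_of_hc_cm` — `HC_CM ⟹` the rational `(2,2)`-classes of `P_F⁴ = (cmProdAV F h₃ N Θ₀).powSucc 3` are
  algebraic (any CM field, any family `Θ₀`);
* **`hc_cm_iff_codimTwo_powSucc_three`** — `HC_CM ⟺` for every Galois CM field `F` with `[F:ℚ] ≥ 6` and every enumeration
  `Θ₀ : Fin (N+1) → CMType F` of its CM types, every rational `(2,2)`-class on `(∏_i A_{(F,Θ₀ i)})⁴` is algebraic;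
* **`hc_cm_of_forall_galois_exists_codimTwo_powSucc_three`** — it suffices to check, for each such `F`, ONE family `Θ₀` meeting
  every `(Aut F × {1, bar})`-orbit of CM types.

Neither side is asserted anywhere.

## References
* [Pohlmann1968] H. Pohlmann, Ann. of Math. 88 (1968), Thm. 1.
* [Andre1992HodgeCM] Y. André, Progr. Math. 102 (1992), Théorème pp. 4–5.
* [Milne2020HodgeClassesAV] J. S. Milne, *Hodge classes on abelian varieties* (2020), Theorem 1.
* [MumfordAV1970] D. Mumford, *Abelian Varieties* (1970), §19 Thm. 1 and Remark p. 169.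
* [Deligne1982HodgeCycles] P. Deligne, LNM 900 (1982), §5 (b).
-/

noncomputable section

open CategoryTheory NumberField
open Literature.AlgebraicGeometry Literature.AlgebraicGeometry.Motives Literature.AlgebraicGeometry.HodgeTheory
open Literature.AlgebraicGeometry.ComplexMultiplication Literature.AlgebraicGeometry.Milne1999
open Literature.NumberTheory.ComplexMultiplication.CMTypeOps (bar)
open Literature.NumberTheory.Automorphic.PicardCM (CMAbelianVarietyRealised)
open Literature.NumberTheory.Automorphic.PicardCM.CMCode (cmTypeMap)
open Summit.HodgeConjecture.CorCM.Domination

namespace Summit.HodgeConjecture.CorCM.SliceExhaustion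

variable {F : Type} [Field F] [NumberField F] [IsCMField F]

/-- **`HC_CM ⟹` the rational `(2,2)`-classes of `P_F⁴ = (∏_i A_{(F,Θ₀ i)})⁴` are algebraic** (the power is an isogeny factor
of a longer product of realisations, part 1 `exists_avDominatedBy_powSucc_cmProdAV`, on which `HC_CM` gives
`HodgeConjectureFor`). [cite: MumfordAV1970, §19] -/
theorem codimTwo_powSucc_three_of_hc_cm (h : HC_CM) (h₃ : CMAbelianVarietyRealised) {N : ℕ}
    (Θ₀ : Fin (N + 1) → CMType F) (c : complexBetti ((cmProdAV F h₃ N Θ₀).powSucc 3).X (2 * 2))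
    (hcQ : IsRationalClass c)
    (hcH : IsOfHodgeType ((cmProdAV F h₃ N Θ₀).powSucc 3).dim ((cmProdAV F h₃ N Θ₀).powSucc 3).X (2 * 2) 2 2 c) :
    c ∈ algebraicClasses ((cmProdAV F h₃ N Θ₀).powSucc 3).X 2 := by
  obtain ⟨n, Θ, hdom⟩ := exists_avDominatedBy_powSucc_cmProdAV h₃ Θ₀ 3
  exact (hodgeConjectureFor_of_avDominatedBy (hodgeConjectureFor_cmProdAV_of_hc_cm h h₃ n Θ) hdom).2 2 c hcQ hcH

/-- **Codimension-two HC on `P_F⁴` gives codimension-two HC on every `∏_{j<4} A_{(F,Θ_j)}`**, for `Θ₀` meeting every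
`(Aut F × {1, bar})`-orbit of CM types (`avDominatedBy_cmProdAV_powSucc_of_meets` at `n = 3`, then
`AndreSplit.mem_algebraicClasses_of_avDominatedBy`).
[cite: MumfordAV1970, §19] [cite: Deligne1982HodgeCycles, §5 (b)] -/
theorem codimTwo_cmProdAV_three_of_powSucc_three (h₃ : CMAbelianVarietyRealised) {N : ℕ} {Θ₀ : Fin (N + 1) → CMType F}
    (hΘ₀ : ∀ Φ : CMType F, ∃ (i : Fin (N + 1)) (e : F ≃+* F), Θ₀ i = cmTypeMap e Φ ∨ Θ₀ i = cmTypeMap e (bar Φ))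
    (hP : ∀ c : complexBetti ((cmProdAV F h₃ N Θ₀).powSucc 3).X (2 * 2), IsRationalClass c →
      IsOfHodgeType ((cmProdAV F h₃ N Θ₀).powSucc 3).dim ((cmProdAV F h₃ N Θ₀).powSucc 3).X (2 * 2) 2 2 c →
        c ∈ algebraicClasses ((cmProdAV F h₃ N Θ₀).powSucc 3).X 2)
    (Θ : Fin 4 → CMType F) (c : complexBetti (cmProdAV F h₃ 3 Θ).X (2 * 2)) (hcQ : IsRationalClass c)
    (hcH : IsOfHodgeType (cmProdAV F h₃ 3 Θ).dim (cmProdAV F h₃ 3 Θ).X (2 * 2) 2 2 c) :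
    c ∈ algebraicClasses (cmProdAV F h₃ 3 Θ).X 2 :=
  AndreSplit.mem_algebraicClasses_of_avDominatedBy (avDominatedBy_cmProdAV_powSucc_of_meets h₃ hΘ₀ 3 Θ) hP c hcQ hcH

/-- **`HC_CM` from codimension two on ONE abelian variety per Galois CM field**: if for every Galois CM field `F` with
`[F:ℚ] ≥ 6` there is a family `Θ₀` meeting every `(Aut F × {1, bar})`-orbit of CM types such that every rational
`(2,2)`-class on `(∏_i A_{(F,Θ₀ i)})⁴` is algebraic, then `HC_CM` (part 4 `hc_cm_of_codimTwo_cmProdAV`).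
[cite: Pohlmann1968, Thm. 1] [cite: Andre1992HodgeCM, Théorème (pp. 4–5)] [cite: Milne2020HodgeClassesAV, Theorem 1] -/
theorem hc_cm_of_forall_galois_exists_codimTwo_powSucc_three
    (h : ∀ (F : Type) [Field F] [NumberField F] [IsCMField F], IsGalois ℚ F → 6 ≤ Module.finrank ℚ F →
      ∃ (N : ℕ) (Θ₀ : Fin (N + 1) → CMType F),
        (∀ Φ : CMType F, ∃ (i : Fin (N + 1)) (e : F ≃+* F), Θ₀ i = cmTypeMap e Φ ∨ Θ₀ i = cmTypeMap e (bar Φ)) ∧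
        ∀ c : complexBetti ((cmProdAV F cmAbelianVarietyRealised_holds N Θ₀).powSucc 3).X (2 * 2), IsRationalClass c →
          IsOfHodgeType ((cmProdAV F cmAbelianVarietyRealised_holds N Θ₀).powSucc 3).dim
            ((cmProdAV F cmAbelianVarietyRealised_holds N Θ₀).powSucc 3).X (2 * 2) 2 2 c →
          c ∈ algebraicClasses ((cmProdAV F cmAbelianVarietyRealised_holds N Θ₀).powSucc 3).X 2) : HC_CM := by
  refine hc_cm_of_codimTwo_cmProdAV fun F _ _ _ hG h6 Θ c hcQ hcH => ?_
  obtain ⟨N, Θ₀, hΘ₀, hP⟩ := h F hG h6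
  exact codimTwo_cmProdAV_three_of_powSucc_three _ hΘ₀ hP Θ c hcQ hcH

/-- **`HC_CM ⟺` ONE abelian variety and ONE codimension per Galois CM field**: the Hodge conjecture for complex abelian
varieties of CM type holds iff, for every Galois CM field `F` with `[F:ℚ] ≥ 6` and every enumeration `Θ₀ : Fin (N+1) → CMType F`
(surjective) of its CM types, every rational class of Hodge type `(2,2)` in `H⁴` of the fourth power
`(∏_i A_{(F,Θ₀ i)})⁴ = (cmProdAV F h₃ N Θ₀).powSucc 3` is algebraic.  Neither side is asserted.
[cite: Pohlmann1968, Thm. 1] [cite: Andre1992HodgeCM, Théorème (pp. 4–5)] [cite: Milne2020HodgeClassesAV, Theorem 1]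
[cite: MumfordAV1970, §19 Thm. 1 and Remark p. 169] -/
theorem hc_cm_iff_codimTwo_powSucc_three :
    HC_CM ↔ ∀ (F : Type) [Field F] [NumberField F] [IsCMField F], IsGalois ℚ F → 6 ≤ Module.finrank ℚ F →
      ∀ (N : ℕ) (Θ₀ : Fin (N + 1) → CMType F), Function.Surjective Θ₀ →
        ∀ c : complexBetti ((cmProdAV F cmAbelianVarietyRealised_holds N Θ₀).powSucc 3).X (2 * 2), IsRationalClass c →
          IsOfHodgeType ((cmProdAV F cmAbelianVarietyRealised_holds N Θ₀).powSucc 3).dim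
            ((cmProdAV F cmAbelianVarietyRealised_holds N Θ₀).powSucc 3).X (2 * 2) 2 2 c →
          c ∈ algebraicClasses ((cmProdAV F cmAbelianVarietyRealised_holds N Θ₀).powSucc 3).X 2 := by
  refine ⟨fun h F _ _ _ _ _ N Θ₀ _ c hcQ hcH => codimTwo_powSucc_three_of_hc_cm h _ Θ₀ c hcQ hcH, fun h => ?_⟩
  refine hc_cm_of_forall_galois_exists_codimTwo_powSucc_three fun F _ _ _ hG h6 => ?_
  obtain ⟨N, Θ₀, hΘ₀⟩ := exists_surjective_cmType F
  exact ⟨N, Θ₀, meets_of_surjective hΘ₀, h F hG h6 N Θ₀ hΘ₀⟩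

end Summit.HodgeConjecture.CorCM.SliceExhaustion

end
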